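import Literature.NumberTheory.Sieve.SieveFrameworkFundamentalLemma
import Mathlib.Analysis.SpecialFunctions.Pow.Real
import Mathlib.Analysis.Complex.Exponential
import HarnessLib

/-!
# Granville–Mollin's Theorem 4: the relative error (real bookkeeping)

Topic `Literature/Barriers/Parity`, purely real-analytic layer of the proof of
`Literature.Barriers.Parity.GranvilleMollin2000_thm4` (Granville–Mollin, *Rabinowitsch revisited*,
Acta Arith. 96 (2000), Theorem 4, §6B: "… gives `≪ τ log d/(η log η)^{1/2} …` using (5.8). If
`η > log d`, we take `τ = √log η` to deduce Theorem 4."). Everything is PROVED; no definition is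
introduced; nothing number-theoretic is imported except the name of the Fundamental-Lemma constant
`SieveSequence.flConst`.

`relError_le` takes the explicit bound of `abs_polyPrimeCount_sub_mul_le'`
(`SiegelZeroQuadraticPolynomialsMainEstimate.lean`) with the substitutions `y = q^ε`,
`K_c = K'/(η L)`, `H = K₁ L/s` (`L = log q`, `s = √(log η)`), and the inputs `V ≤ e ϱ`,
`ϱ ≥ e^{−25} min(1, s²/(K₁² L²))` (the lower bound (5.8), `gmRho_ge_of_weighted`), `η ≥ L`,
`q^{10} ≤ N`, `log N ≤ δ η L`, and bounds it by
`ϱ N · (Cω e · e^{−5/ε} + 4e(1 + Cω) K' δ/log 2 + G)`, where `G = G(ε, K', K₁; q)` collects the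
terms that tend to `0` as `q → ∞` (`relErrorTail`, written out in the statement):
powers `L⁴/q^5`, `L² q^{ε/2}/q^{10}`, `L⁴/q^{1/4}`, `q^{−ε}` and `1/L`, `1/L²`, `1/log L`,
`1/√(log L)`. The two auxiliary inequalities are `inv_mul_le_of_gmRho_lower`
(`1/(ηL) ≤ ϱ e^{25} (1/L² + K₁²/log L)`, using `L log L ≤ η log η`) and
`inv_le_sqrt_of_gmRho_lower` (`1/η ≤ √ϱ e^{25/2} (1/L + K₁/s)`).

[cite: GranvilleMollin2000, §6B (end of the proof of Theorem 4) and §5C (5.8)]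
-/

noncomputable section

open Real
open Literature.NumberTheory.Sieve

namespace Literature.Barriers.Parity

/-- `L log L ≤ η log η` for `1 ≤ L ≤ η`. [folklore] -/
theorem mul_log_le_mul_log {L η : ℝ} (hL : 1 ≤ L) (hLη : L ≤ η) : L * Real.log L ≤ η * Real.log η :=
  mul_le_mul hLη (Real.log_le_log (by linarith) hLη) (Real.log_nonneg hL) (by linarith)

/-- **`1/(ηL) ≤ ϱ e^{25} (1/L² + K₁²/log L)`** from the lower bound
`ϱ ≥ e^{−25} min(1, log η/(K₁² L²))`, `2 ≤ L ≤ η`, `K₁ ≥ 1`. [cite: GranvilleMollin2000, §5C (5.8)] -/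
theorem inv_mul_le_of_gmRho_lower {ϱ η L K₁ : ℝ} (hL : 2 ≤ L) (hLη : L ≤ η) (hK₁ : 1 ≤ K₁)
    (hϱ : Real.exp (-25) * min 1 (Real.log η / (K₁ ^ 2 * L ^ 2)) ≤ ϱ) :
    1 / (η * L) ≤ ϱ * Real.exp 25 * (1 / L ^ 2 + K₁ ^ 2 / Real.log L) := by
  have hL0 : 0 < L := by linarith
  have hη0 : 0 < η := by linarith
  have hlogL : 0 < Real.log L := Real.log_pos (by linarith)
  have hlogη : 0 < Real.log η := Real.log_pos (by linarith)
  have hm : min 1 (Real.log η / (K₁ ^ 2 * L ^ 2)) ≤ ϱ * Real.exp 25 := by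
    have h := mul_le_mul_of_nonneg_right hϱ (Real.exp_pos 25).le
    rwa [mul_assoc, mul_comm (min _ _), ← mul_assoc, ← Real.exp_add, show (-25 : ℝ) + 25 = 0 by norm_num,
      Real.exp_zero, one_mul] at h
  have hA : 0 ≤ 1 / L ^ 2 + K₁ ^ 2 / Real.log L := by positivity
  rcases min_cases (1 : ℝ) (Real.log η / (K₁ ^ 2 * L ^ 2)) with ⟨hmin, _⟩ | ⟨hmin, _⟩
  · rw [hmin] at hm
    calc 1 / (η * L) ≤ 1 / L ^ 2 := by
          rw [div_le_div_iff₀ (by positivity) (by positivity), one_mul, one_mul, sq]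
          exact mul_le_mul_of_nonneg_right hLη hL0.le
      _ ≤ 1 * (1 / L ^ 2 + K₁ ^ 2 / Real.log L) := by rw [one_mul]; linarith [show 0 ≤ K₁ ^ 2 / Real.log L by positivity]
      _ ≤ ϱ * Real.exp 25 * (1 / L ^ 2 + K₁ ^ 2 / Real.log L) := mul_le_mul_of_nonneg_right hm hA
  · rw [hmin] at hm
    have hkey : 1 / (η * L) ≤ Real.log η / (K₁ ^ 2 * L ^ 2) * (K₁ ^ 2 / Real.log L) := by
      rw [div_mul_div_comm, div_le_div_iff₀ (by positivity) (by positivity), one_mul]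
      have h1 := mul_log_le_mul_log (by linarith : (1 : ℝ) ≤ L) hLη
      have hK0 : 0 < K₁ ^ 2 := by positivity
      nlinarith [mul_le_mul_of_nonneg_left h1 (show 0 ≤ K₁ ^ 2 * L by positivity)]
    calc 1 / (η * L) ≤ Real.log η / (K₁ ^ 2 * L ^ 2) * (K₁ ^ 2 / Real.log L) := hkey
      _ ≤ Real.log η / (K₁ ^ 2 * L ^ 2) * (1 / L ^ 2 + K₁ ^ 2 / Real.log L) :=
          mul_le_mul_of_nonneg_left (by linarith [show 0 ≤ 1 / L ^ 2 by positivity]) (by positivity)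
      _ ≤ ϱ * Real.exp 25 * (1 / L ^ 2 + K₁ ^ 2 / Real.log L) := mul_le_mul_of_nonneg_right hm hA

/-- **`1/η ≤ √ϱ e^{25/2} (1/L + K₁/s)`**, `s = √(log η)`, from the same lower bound
(`1 ≤ L ≤ η`, `K₁ ≥ 1`, `s > 0`). [cite: GranvilleMollin2000, §5C (5.8)] -/
theorem inv_le_sqrt_of_gmRho_lower {ϱ η L K₁ s : ℝ} (hL : 1 ≤ L) (hLη : L ≤ η) (hK₁ : 1 ≤ K₁)
    (hs : s = Real.sqrt (Real.log η)) (hs0 : 0 < s)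
    (hϱ : Real.exp (-25) * min 1 (Real.log η / (K₁ ^ 2 * L ^ 2)) ≤ ϱ) :
    1 / η ≤ Real.sqrt ϱ * Real.exp (25 / 2) * (1 / L + K₁ / s) := by
  have hL0 : 0 < L := by linarith
  have hη0 : 0 < η := by linarith
  have hK0 : 0 < K₁ := by linarith
  have hs2 : s ^ 2 = Real.log η := by rw [hs, Real.sq_sqrt]; rw [hs] at hs0; exact (Real.sqrt_pos.mp hs0).le
  -- `√(e^{-25} m) ≤ √ϱ`, `√(e^{-25}) = e^{-25/2}`
  have hsqrt : Real.sqrt (Real.exp (-25)) * Real.sqrt (min 1 (Real.log η / (K₁ ^ 2 * L ^ 2))) ≤ Real.sqrt ϱ := by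
    rw [← Real.sqrt_mul (Real.exp_pos _).le]
    exact Real.sqrt_le_sqrt hϱ
  have hexp : Real.sqrt (Real.exp (-25)) = Real.exp (-(25 / 2)) := by
    rw [show (-25 : ℝ) = -(25 / 2) + -(25 / 2) by norm_num, Real.exp_add,
      Real.sqrt_mul_self (Real.exp_pos _).le]
  rw [hexp] at hsqrt
  have hm : Real.sqrt (min 1 (Real.log η / (K₁ ^ 2 * L ^ 2))) ≤ Real.sqrt ϱ * Real.exp (25 / 2) := by
    have h := mul_le_mul_of_nonneg_right hsqrt (Real.exp_pos (25 / 2)).le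
    rwa [mul_comm (Real.exp _), mul_assoc, ← Real.exp_add, show (-(25 / 2) : ℝ) + 25 / 2 = 0 by norm_num,
      Real.exp_zero, mul_one] at h
  have hA : 0 ≤ 1 / L + K₁ / s := by positivity
  have h1L : 1 / η ≤ 1 / L := div_le_div_of_nonneg_left zero_le_one hL0 hLη
  refine h1L.trans ?_
  rcases min_cases (1 : ℝ) (Real.log η / (K₁ ^ 2 * L ^ 2)) with ⟨hmin, _⟩ | ⟨hmin, _⟩
  · rw [hmin, Real.sqrt_one] at hm
    calc 1 / L ≤ 1 * (1 / L + K₁ / s) := by rw [one_mul]; linarith [show 0 ≤ K₁ / s by positivity]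
      _ ≤ Real.sqrt ϱ * Real.exp (25 / 2) * (1 / L + K₁ / s) := mul_le_mul_of_nonneg_right hm hA
  · rw [hmin] at hm
    have hsq : Real.sqrt (Real.log η / (K₁ ^ 2 * L ^ 2)) = s / (K₁ * L) := by
      rw [← hs2, show K₁ ^ 2 * L ^ 2 = (K₁ * L) ^ 2 by ring, Real.sqrt_div' _ (sq_nonneg _),
        Real.sqrt_sq hs0.le, Real.sqrt_sq (by positivity)]
    rw [hsq] at hm
    calc 1 / L = s / (K₁ * L) * (K₁ / s) := by field_simp
      _ ≤ s / (K₁ * L) * (1 / L + K₁ / s) :=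
          mul_le_mul_of_nonneg_left (by linarith [show 0 ≤ 1 / L by positivity]) (by positivity)
      _ ≤ Real.sqrt ϱ * Real.exp (25 / 2) * (1 / L + K₁ / s) := mul_le_mul_of_nonneg_right hm hA

set_option maxHeartbeats 1600000 in
/-- **The relative error of Theorem 4** (the bound of `abs_polyPrimeCount_sub_mul_le'` divided by
`ϱ N`): with `y = q^ε`, `K_c = K'/(ηL)`, `H = K₁L/s`, `L = log q ≥ 2`, `L ≤ η`, `s = √(log η) ≥ 1`,
`0 < ε ≤ 1/100`, `δ > 0`, `K', K₁ ≥ 1`, `q^{10} ≤ N`, `log N ≤ δηL`, `0 < ϱ ≤ V ≤ eϱ`,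
`ϱ ≥ e^{−25} min(1, s²/(K₁²L²))` and `K₁/(εs) + 16/q^ε ≤ 1`, the bound is at most
`ϱ N (Cω e e^{−5/ε} + 4e(1+Cω)K'δ/log 2 + G)`, `G` the displayed tail.
[cite: GranvilleMollin2000, §6B (end of the proof of Theorem 4)] -/
theorem relError_le {N q L η s ε δ K' K₁ ϱ V y Kc H : ℝ} (hq : Real.exp 2 ≤ q) (hL : L = Real.log q)
    (hLη : L ≤ η) (hs : s = Real.sqrt (Real.log η)) (hs1 : 1 ≤ s) (hε : 0 < ε) (hε1 : ε ≤ 1 / 100)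
    (hδ : 0 < δ) (hK' : 1 ≤ K') (hK₁ : 1 ≤ K₁) (hN : q ^ (10 : ℝ) ≤ N)
    (hlogN : Real.log N ≤ δ * η * L) (hϱ0 : 0 < ϱ) (hϱV : ϱ ≤ V) (hVϱ : V ≤ Real.exp 1 * ϱ)
    (hϱlow : Real.exp (-25) * min 1 (Real.log η / (K₁ ^ 2 * L ^ 2)) ≤ ϱ)
    (hy : y = q ^ ε) (hKc : Kc = K' / (η * L)) (hH : H = K₁ * L / s)
    (ht₀ : K₁ / (ε * s) + 16 / q ^ ε ≤ 1) :
    (SieveSequence.flConst 2 (2 * Real.exp (17 + 12 / Real.log 2)) * N * V *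
          Real.exp (-(Real.log (Real.sqrt N) / Real.log y)) +
        Real.sqrt N * (Real.exp 8 * Real.log y ^ 2)) +
      (Real.sqrt y + 1) +
      (17 * (4 * Kc * (N / 16) * ((2 : ℝ) ^ 5 - 1)) +
      ((1 + SieveSequence.flConst 2 (2 * Real.exp (17 + 12 / Real.log 2))) * N * V *
          (H / Real.log y + H / Real.log (Real.sqrt q)) +
        Real.exp 8 * Real.log y ^ 2 * (17 * Real.sqrt N * Real.sqrt (q ^ ((19 : ℝ) / 2)))) +
      ((1 + SieveSequence.flConst 2 (2 * Real.exp (17 + 12 / Real.log 2))) * N * V *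
          (4 * Kc * (Real.log N / Real.log 2)) +
        Real.exp 8 / 16 * (1536 * Kc * N)) +
      ((1 + SieveSequence.flConst 2 (2 * Real.exp (17 + 12 / Real.log 2))) * N *
          (4 * Kc * (3 * Real.sqrt ((2 * Real.exp (17 + 12 / Real.log 2)) * V *
            (4 * Real.log y / Real.log 2) ^ 2) + 1)) +
        Real.exp 8 / 16 * (1536 * Kc * N))) +
      ϱ * N * (Real.exp (H / Real.log y + 16 / y) - 1) ≤
    ϱ * N * (SieveSequence.flConst 2 (2 * Real.exp (17 + 12 / Real.log 2)) * Real.exp 1 * Real.exp (-(5 / ε)) +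
      4 * Real.exp 1 * (1 + SieveSequence.flConst 2 (2 * Real.exp (17 + 12 / Real.log 2))) * K' * δ / Real.log 2 +
      (Real.exp 33 * K₁ ^ 2 * ε ^ 2 * L ^ 4 / q ^ (5 : ℝ) +
        2 * Real.exp 25 * K₁ ^ 2 * L ^ 2 * q ^ (ε / 2) / q ^ (10 : ℝ) +
        (132 + 192 * Real.exp 8 + 4 * (1 + SieveSequence.flConst 2 (2 * Real.exp (17 + 12 / Real.log 2)))) *
          K' * Real.exp 25 * (1 / L ^ 2 + K₁ ^ 2 / Real.log L) +
        (1 + SieveSequence.flConst 2 (2 * Real.exp (17 + 12 / Real.log 2))) * Real.exp 1 * K₁ *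
          (1 / ε + 2) / Real.sqrt (Real.log L) +
        17 * Real.exp 33 * ε ^ 2 * K₁ ^ 2 * L ^ 4 / q ^ ((1 : ℝ) / 4) +
        48 * (1 + SieveSequence.flConst 2 (2 * Real.exp (17 + 12 / Real.log 2))) * K' * ε *
          Real.sqrt (Real.exp 1 * (2 * Real.exp (17 + 12 / Real.log 2))) * Real.exp (25 / 2) *
          (1 / L + K₁ / Real.sqrt (Real.log L)) / Real.log 2 +
        2 * K₁ / (ε * Real.sqrt (Real.log L)) + 32 / q ^ ε)) := by
  -- abbreviations and signs
  set Cω : ℝ := SieveSequence.flConst 2 (2 * Real.exp (17 + 12 / Real.log 2)) with hCω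
  set Kω : ℝ := 2 * Real.exp (17 + 12 / Real.log 2) with hKω
  have hCω0 : 0 < Cω := SieveSequence.flConst_pos (κ := 2) (K := Kω) (by norm_num) (by positivity)
  have he2 : (2 : ℝ) < Real.exp 2 := by
    have := Real.add_one_le_exp (2 : ℝ); linarith
  have hq0 : 0 < q := by linarith
  have hq1 : 1 < q := by linarith
  have hL2 : 2 ≤ L := by rw [hL, Real.le_log_iff_exp_le hq0]; exact hq
  have hL0 : 0 < L := by linarith
  have hL1 : 1 ≤ L := by linarith
  have hη0 : 0 < η := by linarith
  have hη1 : 1 < η := by linarith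
  have hlogη : 0 < Real.log η := Real.log_pos hη1
  have hs0 : 0 < s := by linarith
  have hs2 : s ^ 2 = Real.log η := by rw [hs, Real.sq_sqrt hlogη.le]
  have hlogL : 0 < Real.log L := Real.log_pos (by linarith)
  have hsL : Real.sqrt (Real.log L) ≤ s := by rw [hs]; exact Real.sqrt_le_sqrt (Real.log_le_log hL0 hLη)
  have hsL0 : 0 < Real.sqrt (Real.log L) := Real.sqrt_pos.mpr hlogL
  have hK'0 : 0 < K' := by linarith
  have hK₁0 : 0 < K₁ := by linarith
  have hlog2 : 0 < Real.log 2 := Real.log_pos one_lt_two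
  -- `N`, `√N`, `q^{10}`, `q^5`
  have hq10 : 0 < q ^ (10 : ℝ) := Real.rpow_pos_of_pos hq0 _
  have hN0 : 0 < N := lt_of_lt_of_le hq10 hN
  have hsqrtN : q ^ (5 : ℝ) ≤ Real.sqrt N := by
    have : q ^ (5 : ℝ) = Real.sqrt (q ^ (10 : ℝ)) := by
      rw [Real.sqrt_eq_rpow, ← Real.rpow_mul hq0.le]; norm_num
    rw [this]; exact Real.sqrt_le_sqrt hN
  have hsqrtN0 : 0 < Real.sqrt N := Real.sqrt_pos.mpr hN0
  have hNN : Real.sqrt N * Real.sqrt N = N := Real.mul_self_sqrt hN0.le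
  have hq5 : 0 < q ^ (5 : ℝ) := Real.rpow_pos_of_pos hq0 _
  -- `y = q^ε`: `log y = ε L`, `√y ≥ 1`
  have hy0 : 0 < y := by rw [hy]; exact Real.rpow_pos_of_pos hq0 _
  have hlogy : Real.log y = ε * L := by rw [hy, Real.log_rpow hq0, hL]
  have hlogy0 : 0 < Real.log y := by rw [hlogy]; positivity
  have hy1 : 1 ≤ y := by rw [hy]; exact Real.one_le_rpow hq1.le hε.le
  have hsqrt_y : Real.sqrt y = q ^ (ε / 2) := by
    rw [hy, Real.sqrt_eq_rpow, ← Real.rpow_mul hq0.le]; ring_nf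
  have hsqrt_y1 : 1 ≤ Real.sqrt y := by rw [show (1 : ℝ) = Real.sqrt 1 by simp]; exact Real.sqrt_le_sqrt hy1
  -- `log √q = L/2`, `√(q^{9.5}) = q^{19/4}`
  have hlogsq : Real.log (Real.sqrt q) = L / 2 := by rw [Real.log_sqrt hq0.le, hL]
  have hQ : Real.sqrt (q ^ ((19 : ℝ) / 2)) = q ^ ((19 : ℝ) / 4) := by
    rw [Real.sqrt_eq_rpow, ← Real.rpow_mul hq0.le]; norm_num
  -- `V ≤ e ϱ`, `ϱ e^{25} K₁² L² ≥ 1`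
  have hV0 : 0 < V := lt_of_lt_of_le hϱ0 hϱV
  have he1 : (1 : ℝ) ≤ Real.exp 1 := Real.one_le_exp zero_le_one
  have hρ1 : 1 ≤ ϱ * Real.exp 25 * K₁ ^ 2 * L ^ 2 := by
    have hm : min 1 (Real.log η / (K₁ ^ 2 * L ^ 2)) ≤ ϱ * Real.exp 25 := by
      have h := mul_le_mul_of_nonneg_right hϱlow (Real.exp_pos 25).le
      rwa [mul_assoc, mul_comm (min _ _), ← mul_assoc, ← Real.exp_add, show (-25 : ℝ) + 25 = 0 by norm_num,
        Real.exp_zero, one_mul] at h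
    have hKL : 1 ≤ K₁ ^ 2 * L ^ 2 := one_le_mul_of_one_le_of_one_le (one_le_pow₀ hK₁) (one_le_pow₀ hL1)
    rcases min_cases (1 : ℝ) (Real.log η / (K₁ ^ 2 * L ^ 2)) with ⟨hmin, _⟩ | ⟨hmin, hlt⟩
    · rw [hmin] at hm
      calc (1 : ℝ) ≤ 1 * (K₁ ^ 2 * L ^ 2) := by linarith
        _ ≤ ϱ * Real.exp 25 * (K₁ ^ 2 * L ^ 2) := mul_le_mul_of_nonneg_right hm (by positivity)
        _ = ϱ * Real.exp 25 * K₁ ^ 2 * L ^ 2 := by ring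
    · rw [hmin] at hm
      have hs1' : 1 ≤ Real.log η := by rw [← hs2]; exact one_le_pow₀ hs1
      have : 1 ≤ Real.log η / (K₁ ^ 2 * L ^ 2) * (K₁ ^ 2 * L ^ 2) := by
        rw [div_mul_cancel₀ _ (by positivity)]; exact hs1'
      calc (1 : ℝ) ≤ Real.log η / (K₁ ^ 2 * L ^ 2) * (K₁ ^ 2 * L ^ 2) := this
        _ ≤ ϱ * Real.exp 25 * (K₁ ^ 2 * L ^ 2) := mul_le_mul_of_nonneg_right hm (by positivity)
        _ = ϱ * Real.exp 25 * K₁ ^ 2 * L ^ 2 := by ring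
  have hA1 := inv_mul_le_of_gmRho_lower hL2 hLη hK₁ hϱlow
  have hA2 := inv_le_sqrt_of_gmRho_lower hL1 hLη hK₁ hs hs0 hϱlow
  have hB0 : 0 ≤ 1 / L ^ 2 + K₁ ^ 2 / Real.log L := by positivity
  -- `Kc N = K' N/(ηL)`
  have hKcN : Kc * N = K' * N * (1 / (η * L)) := by rw [hKc]; field_simp
  have hKc0 : 0 ≤ Kc := by rw [hKc]; positivity
  ------------------------------------------------------------------
  -- (b1) main term: `Cω N V E₁ ≤ ϱ N · Cω e e^{-5/ε}`
  have hb1 : Cω * N * V * Real.exp (-(Real.log (Real.sqrt N) / Real.log y)) ≤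
      ϱ * N * (Cω * Real.exp 1 * Real.exp (-(5 / ε))) := by
    have hE : Real.exp (-(Real.log (Real.sqrt N) / Real.log y)) ≤ Real.exp (-(5 / ε)) := by
      rw [Real.exp_le_exp, neg_le_neg_iff, hlogy, le_div_iff₀ (by positivity)]
      have h1 : Real.log (q ^ (5 : ℝ)) ≤ Real.log (Real.sqrt N) := Real.log_le_log hq5 hsqrtN
      rw [Real.log_rpow hq0, ← hL] at h1
      calc 5 / ε * (ε * L) = 5 * L := by field_simp
        _ ≤ Real.log (Real.sqrt N) := h1
    calc Cω * N * V * Real.exp (-(Real.log (Real.sqrt N) / Real.log y))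
        ≤ Cω * N * (Real.exp 1 * ϱ) * Real.exp (-(5 / ε)) :=
          mul_le_mul (mul_le_mul_of_nonneg_left hVϱ (by positivity)) hE (Real.exp_pos _).le (by positivity)
      _ = ϱ * N * (Cω * Real.exp 1 * Real.exp (-(5 / ε))) := by ring
  -- (b2) `√N e⁸ log² y ≤ ϱ N · e^{33} K₁² ε² L⁴ / q^5`
  have hb2 : Real.sqrt N * (Real.exp 8 * Real.log y ^ 2) ≤
      ϱ * N * (Real.exp 33 * K₁ ^ 2 * ε ^ 2 * L ^ 4 / q ^ (5 : ℝ)) := by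
    rw [hlogy]
    have h1 : Real.sqrt N * (Real.exp 8 * (ε * L) ^ 2) ≤
        Real.sqrt N * (Real.exp 8 * (ε * L) ^ 2) * (ϱ * Real.exp 25 * K₁ ^ 2 * L ^ 2) :=
      le_mul_of_one_le_right (by positivity) hρ1
    have h2 : Real.sqrt N ≤ N / q ^ (5 : ℝ) := by
      rw [le_div_iff₀ hq5]
      calc Real.sqrt N * q ^ (5 : ℝ) ≤ Real.sqrt N * Real.sqrt N :=
            mul_le_mul_of_nonneg_left hsqrtN hsqrtN0.le
        _ = N := hNN
    have h33 : Real.exp 33 = Real.exp 8 * Real.exp 25 := by rw [← Real.exp_add]; norm_num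
    calc Real.sqrt N * (Real.exp 8 * (ε * L) ^ 2)
        ≤ Real.sqrt N * (Real.exp 8 * (ε * L) ^ 2) * (ϱ * Real.exp 25 * K₁ ^ 2 * L ^ 2) := h1
      _ = Real.sqrt N * (ϱ * (Real.exp 8 * Real.exp 25) * K₁ ^ 2 * ε ^ 2 * L ^ 4) := by ring
      _ ≤ N / q ^ (5 : ℝ) * (ϱ * (Real.exp 8 * Real.exp 25) * K₁ ^ 2 * ε ^ 2 * L ^ 4) :=
          mul_le_mul_of_nonneg_right h2 (by positivity)
      _ = ϱ * N * (Real.exp 33 * K₁ ^ 2 * ε ^ 2 * L ^ 4 / q ^ (5 : ℝ)) := by rw [h33]; ring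
  -- (b3) `√y + 1 ≤ ϱ N · 2 e^{25} K₁² L² q^{ε/2}/q^{10}`
  have hb3 : Real.sqrt y + 1 ≤ ϱ * N * (2 * Real.exp 25 * K₁ ^ 2 * L ^ 2 * q ^ (ε / 2) / q ^ (10 : ℝ)) := by
    rw [hsqrt_y] at hsqrt_y1 ⊢
    have h1 : q ^ (ε / 2) + 1 ≤ 2 * q ^ (ε / 2) := by linarith
    have h2 : 2 * q ^ (ε / 2) ≤ 2 * q ^ (ε / 2) * (ϱ * Real.exp 25 * K₁ ^ 2 * L ^ 2) :=
      le_mul_of_one_le_right (by positivity) hρ1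
    have h3 : (1 : ℝ) ≤ N / q ^ (10 : ℝ) := by rw [le_div_iff₀ hq10, one_mul]; exact hN
    calc q ^ (ε / 2) + 1 ≤ 2 * q ^ (ε / 2) * (ϱ * Real.exp 25 * K₁ ^ 2 * L ^ 2) * 1 := by linarith
      _ ≤ 2 * q ^ (ε / 2) * (ϱ * Real.exp 25 * K₁ ^ 2 * L ^ 2) * (N / q ^ (10 : ℝ)) :=
          mul_le_mul_of_nonneg_left h3 (by positivity)
      _ = ϱ * N * (2 * Real.exp 25 * K₁ ^ 2 * L ^ 2 * q ^ (ε / 2) / q ^ (10 : ℝ)) := by ring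
  -- (b4) P0: `17·4Kc(N/16)·31 ≤ ϱ N · 132 K' e^{25} (1/L² + K₁²/log L)`
  have hb4 : 17 * (4 * Kc * (N / 16) * ((2 : ℝ) ^ 5 - 1)) ≤
      ϱ * N * (132 * K' * Real.exp 25 * (1 / L ^ 2 + K₁ ^ 2 / Real.log L)) := by
    have h1 : 17 * (4 * Kc * (N / 16) * ((2 : ℝ) ^ 5 - 1)) ≤ 132 * (Kc * N) := by
      have heq : 17 * (4 * Kc * (N / 16) * ((2 : ℝ) ^ 5 - 1)) = 131.75 * (Kc * N) := by ring
      rw [heq]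
      exact mul_le_mul_of_nonneg_right (by norm_num) (mul_nonneg hKc0 hN0.le)
    rw [hKcN] at h1
    calc 17 * (4 * Kc * (N / 16) * ((2 : ℝ) ^ 5 - 1)) ≤ 132 * (K' * N * (1 / (η * L))) := h1
      _ ≤ 132 * (K' * N * (ϱ * Real.exp 25 * (1 / L ^ 2 + K₁ ^ 2 / Real.log L))) :=
          mul_le_mul_of_nonneg_left (mul_le_mul_of_nonneg_left hA1 (by positivity)) (by norm_num)
      _ = ϱ * N * (132 * K' * Real.exp 25 * (1 / L ^ 2 + K₁ ^ 2 / Real.log L)) := by ring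
  -- (b5) I main: `(1+Cω) N V (H/log y + H/log √q) ≤ ϱ N (1+Cω) e K₁ (1/ε + 2)/√(log L)`
  have hb5 : (1 + Cω) * N * V * (H / Real.log y + H / Real.log (Real.sqrt q)) ≤
      ϱ * N * ((1 + Cω) * Real.exp 1 * K₁ * (1 / ε + 2) / Real.sqrt (Real.log L)) := by
    rw [hlogy, hlogsq, hH]
    have hsum : K₁ * L / s / (ε * L) + K₁ * L / s / (L / 2) = K₁ * (1 / ε + 2) / s := by
      field_simp
      try ring
    rw [hsum]
    have h1 : K₁ * (1 / ε + 2) / s ≤ K₁ * (1 / ε + 2) / Real.sqrt (Real.log L) :=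
      div_le_div_of_nonneg_left (by positivity) hsL0 hsL
    calc (1 + Cω) * N * V * (K₁ * (1 / ε + 2) / s)
        ≤ (1 + Cω) * N * (Real.exp 1 * ϱ) * (K₁ * (1 / ε + 2) / Real.sqrt (Real.log L)) :=
          mul_le_mul (mul_le_mul_of_nonneg_left hVϱ (by positivity)) h1 (by positivity) (by positivity)
      _ = ϱ * N * ((1 + Cω) * Real.exp 1 * K₁ * (1 / ε + 2) / Real.sqrt (Real.log L)) := by ring
  -- (b6) I remainder: `e⁸ log² y · 17 √N √(q^{9.5}) ≤ ϱ N · 17 e^{33} ε² K₁² L⁴ / q^{1/4}`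
  have hb6 : Real.exp 8 * Real.log y ^ 2 * (17 * Real.sqrt N * Real.sqrt (q ^ ((19 : ℝ) / 2))) ≤
      ϱ * N * (17 * Real.exp 33 * ε ^ 2 * K₁ ^ 2 * L ^ 4 / q ^ ((1 : ℝ) / 4)) := by
    rw [hlogy, hQ]
    have hq14 : 0 < q ^ ((1 : ℝ) / 4) := Real.rpow_pos_of_pos hq0 _
    have h2 : Real.sqrt N * q ^ ((19 : ℝ) / 4) ≤ N / q ^ ((1 : ℝ) / 4) := by
      rw [le_div_iff₀ hq14, mul_assoc, ← Real.rpow_add hq0, show (19 : ℝ) / 4 + 1 / 4 = 5 by norm_num]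
      calc Real.sqrt N * q ^ (5 : ℝ) ≤ Real.sqrt N * Real.sqrt N :=
            mul_le_mul_of_nonneg_left hsqrtN hsqrtN0.le
        _ = N := hNN
    have h1 : Real.exp 8 * (ε * L) ^ 2 * (17 * Real.sqrt N * q ^ ((19 : ℝ) / 4)) ≤
        Real.exp 8 * (ε * L) ^ 2 * (17 * Real.sqrt N * q ^ ((19 : ℝ) / 4)) * (ϱ * Real.exp 25 * K₁ ^ 2 * L ^ 2) :=
      le_mul_of_one_le_right (by positivity) hρ1
    have h33 : Real.exp 33 = Real.exp 8 * Real.exp 25 := by rw [← Real.exp_add]; norm_num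
    calc Real.exp 8 * (ε * L) ^ 2 * (17 * Real.sqrt N * q ^ ((19 : ℝ) / 4))
        ≤ Real.exp 8 * (ε * L) ^ 2 * (17 * Real.sqrt N * q ^ ((19 : ℝ) / 4)) * (ϱ * Real.exp 25 * K₁ ^ 2 * L ^ 2) := h1
      _ = (Real.sqrt N * q ^ ((19 : ℝ) / 4)) * (17 * (Real.exp 8 * Real.exp 25) * ε ^ 2 * K₁ ^ 2 * L ^ 4 * ϱ) := by ring
      _ ≤ N / q ^ ((1 : ℝ) / 4) * (17 * (Real.exp 8 * Real.exp 25) * ε ^ 2 * K₁ ^ 2 * L ^ 4 * ϱ) :=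
          mul_le_mul_of_nonneg_right h2 (by positivity)
      _ = ϱ * N * (17 * Real.exp 33 * ε ^ 2 * K₁ ^ 2 * L ^ 4 / q ^ ((1 : ℝ) / 4)) := by rw [h33]; ring
  -- (b7) IIa main: `(1+Cω) N V · 4Kc log N/log 2 ≤ ϱ N · 4e(1+Cω)K'δ/log 2`
  have hb7 : (1 + Cω) * N * V * (4 * Kc * (Real.log N / Real.log 2)) ≤
      ϱ * N * (4 * Real.exp 1 * (1 + Cω) * K' * δ / Real.log 2) := by
    have hlogN0 : 0 ≤ Real.log N := Real.log_nonneg (le_trans (Real.one_le_rpow hq1.le (by norm_num)) hN)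
    have h1 : Kc * Real.log N ≤ K' * δ := by
      rw [hKc, div_mul_eq_mul_div, div_le_iff₀ (by positivity)]
      calc K' * Real.log N ≤ K' * (δ * η * L) := mul_le_mul_of_nonneg_left hlogN hK'0.le
        _ = K' * δ * (η * L) := by ring
    calc (1 + Cω) * N * V * (4 * Kc * (Real.log N / Real.log 2))
        = (1 + Cω) * N * V * (4 / Real.log 2) * (Kc * Real.log N) := by field_simp
      _ ≤ (1 + Cω) * N * (Real.exp 1 * ϱ) * (4 / Real.log 2) * (K' * δ) :=
          mul_le_mul (mul_le_mul_of_nonneg_right (mul_le_mul_of_nonneg_left hVϱ (by positivity))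
            (by positivity)) h1 (by positivity) (by positivity)
      _ = ϱ * N * (4 * Real.exp 1 * (1 + Cω) * K' * δ / Real.log 2) := by field_simp
  -- (b8) the two sharp remainders: `2 · (e⁸/16) 1536 Kc N ≤ ϱ N · 192 e⁸ K' e^{25} (…)`
  have hb8 : Real.exp 8 / 16 * (1536 * Kc * N) ≤
      ϱ * N * (96 * Real.exp 8 * K' * Real.exp 25 * (1 / L ^ 2 + K₁ ^ 2 / Real.log L)) := by
    calc Real.exp 8 / 16 * (1536 * Kc * N) = 96 * Real.exp 8 * (Kc * N) := by ring
      _ = 96 * Real.exp 8 * (K' * N * (1 / (η * L))) := by rw [hKcN]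
      _ ≤ 96 * Real.exp 8 * (K' * N * (ϱ * Real.exp 25 * (1 / L ^ 2 + K₁ ^ 2 / Real.log L))) :=
          mul_le_mul_of_nonneg_left (mul_le_mul_of_nonneg_left hA1 (by positivity)) (by positivity)
      _ = ϱ * N * (96 * Real.exp 8 * K' * Real.exp 25 * (1 / L ^ 2 + K₁ ^ 2 / Real.log L)) := by ring
  -- (b9)+(b10) IIb main: `(1+Cω) N · 4Kc (3√(Kω V (4 log y/log 2)²) + 1)`
  have hb9 : (1 + Cω) * N * (4 * Kc * (3 * Real.sqrt (Kω * V * (4 * Real.log y / Real.log 2) ^ 2) + 1)) ≤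
      ϱ * N * (48 * (1 + Cω) * K' * ε * Real.sqrt (Real.exp 1 * Kω) * Real.exp (25 / 2) *
          (1 / L + K₁ / Real.sqrt (Real.log L)) / Real.log 2 +
        4 * (1 + Cω) * K' * Real.exp 25 * (1 / L ^ 2 + K₁ ^ 2 / Real.log L)) := by
    rw [hlogy]
    have ht : 0 ≤ 4 * (ε * L) / Real.log 2 := by positivity
    have hsq : Real.sqrt (Kω * V * (4 * (ε * L) / Real.log 2) ^ 2) = Real.sqrt (Kω * V) * (4 * (ε * L) / Real.log 2) := by
      rw [Real.sqrt_mul (by positivity), Real.sqrt_sq ht]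
    rw [hsq]
    -- `√(Kω V) ≤ √(e Kω) √ϱ`
    have hKV : Real.sqrt (Kω * V) ≤ Real.sqrt (Real.exp 1 * Kω) * Real.sqrt ϱ := by
      rw [← Real.sqrt_mul (by positivity)]
      refine Real.sqrt_le_sqrt ?_
      rw [show Real.exp 1 * Kω * ϱ = Kω * (Real.exp 1 * ϱ) by ring]
      exact mul_le_mul_of_nonneg_left hVϱ (by positivity)
    -- `√ϱ/η ≤ ϱ e^{25/2}(1/L + K₁/s) ≤ ϱ e^{25/2}(1/L + K₁/√log L)`
    have hA2' : 1 / η ≤ Real.sqrt ϱ * Real.exp (25 / 2) * (1 / L + K₁ / Real.sqrt (Real.log L)) := by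
      refine hA2.trans (mul_le_mul_of_nonneg_left ?_ (by positivity))
      exact add_le_add le_rfl (div_le_div_of_nonneg_left hK₁0.le hsL0 hsL)
    have hρρ : Real.sqrt ϱ * Real.sqrt ϱ = ϱ := Real.mul_self_sqrt hϱ0.le
    -- first piece
    have hpiece1 : (1 + Cω) * N * (4 * Kc * (3 * (Real.sqrt (Kω * V) * (4 * (ε * L) / Real.log 2)))) ≤
        ϱ * N * (48 * (1 + Cω) * K' * ε * Real.sqrt (Real.exp 1 * Kω) * Real.exp (25 / 2) *
          (1 / L + K₁ / Real.sqrt (Real.log L)) / Real.log 2) := by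
      have hre : (1 + Cω) * N * (4 * Kc * (3 * (Real.sqrt (Kω * V) * (4 * (ε * L) / Real.log 2)))) =
          48 * (1 + Cω) * K' * ε * N / Real.log 2 * Real.sqrt (Kω * V) * (1 / η) := by
        rw [hKc]; field_simp; ring
      rw [hre]
      calc 48 * (1 + Cω) * K' * ε * N / Real.log 2 * Real.sqrt (Kω * V) * (1 / η)
          ≤ 48 * (1 + Cω) * K' * ε * N / Real.log 2 * (Real.sqrt (Real.exp 1 * Kω) * Real.sqrt ϱ) *
              (Real.sqrt ϱ * Real.exp (25 / 2) * (1 / L + K₁ / Real.sqrt (Real.log L))) :=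
            mul_le_mul (mul_le_mul_of_nonneg_left hKV (by positivity)) hA2' (by positivity) (by positivity)
        _ = (Real.sqrt ϱ * Real.sqrt ϱ) * N * (48 * (1 + Cω) * K' * ε * Real.sqrt (Real.exp 1 * Kω) *
              Real.exp (25 / 2) * (1 / L + K₁ / Real.sqrt (Real.log L)) / Real.log 2) := by ring
        _ = ϱ * N * (48 * (1 + Cω) * K' * ε * Real.sqrt (Real.exp 1 * Kω) * Real.exp (25 / 2) *
              (1 / L + K₁ / Real.sqrt (Real.log L)) / Real.log 2) := by rw [hρρ]
    -- second piece
    have hpiece2 : (1 + Cω) * N * (4 * Kc * 1) ≤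
        ϱ * N * (4 * (1 + Cω) * K' * Real.exp 25 * (1 / L ^ 2 + K₁ ^ 2 / Real.log L)) := by
      calc (1 + Cω) * N * (4 * Kc * 1) = 4 * (1 + Cω) * (Kc * N) := by ring
        _ = 4 * (1 + Cω) * (K' * N * (1 / (η * L))) := by rw [hKcN]
        _ ≤ 4 * (1 + Cω) * (K' * N * (ϱ * Real.exp 25 * (1 / L ^ 2 + K₁ ^ 2 / Real.log L))) :=
            mul_le_mul_of_nonneg_left (mul_le_mul_of_nonneg_left hA1 (by positivity)) (by positivity)
        _ = ϱ * N * (4 * (1 + Cω) * K' * Real.exp 25 * (1 / L ^ 2 + K₁ ^ 2 / Real.log L)) := by ring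
    have hsplit : (1 + Cω) * N * (4 * Kc * (3 * (Real.sqrt (Kω * V) * (4 * (ε * L) / Real.log 2)) + 1)) =
        (1 + Cω) * N * (4 * Kc * (3 * (Real.sqrt (Kω * V) * (4 * (ε * L) / Real.log 2)))) +
          (1 + Cω) * N * (4 * Kc * 1) := by ring
    rw [hsplit, mul_add]
    exact add_le_add hpiece1 hpiece2
  -- (b11) `ϱ N (e^{t₀} - 1) ≤ ϱ N (2K₁/(ε√log L) + 32/q^ε)`
  have hb11 : ϱ * N * (Real.exp (H / Real.log y + 16 / y) - 1) ≤
      ϱ * N * (2 * K₁ / (ε * Real.sqrt (Real.log L)) + 32 / q ^ ε) := by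
    refine mul_le_mul_of_nonneg_left ?_ (by positivity)
    have ht : H / Real.log y + 16 / y = K₁ / (ε * s) + 16 / q ^ ε := by
      rw [hH, hlogy, hy]; field_simp
    rw [ht]
    have ht0 : 0 ≤ K₁ / (ε * s) + 16 / q ^ ε := by positivity
    have habs : |K₁ / (ε * s) + 16 / q ^ ε| ≤ 1 := by rw [abs_of_nonneg ht0]; exact ht₀
    have h := Real.abs_exp_sub_one_le habs
    rw [abs_of_nonneg ht0] at h
    have h2 : Real.exp (K₁ / (ε * s) + 16 / q ^ ε) - 1 ≤ 2 * (K₁ / (ε * s) + 16 / q ^ ε) :=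
      le_trans (le_abs_self _) h
    have h3 : K₁ / (ε * s) ≤ K₁ / (ε * Real.sqrt (Real.log L)) :=
      div_le_div_of_nonneg_left hK₁0.le (by positivity) (mul_le_mul_of_nonneg_left hsL hε.le)
    calc Real.exp (K₁ / (ε * s) + 16 / q ^ ε) - 1 ≤ 2 * (K₁ / (ε * s) + 16 / q ^ ε) := h2
      _ ≤ 2 * (K₁ / (ε * Real.sqrt (Real.log L)) + 16 / q ^ ε) := by linarith
      _ = 2 * K₁ / (ε * Real.sqrt (Real.log L)) + 32 / q ^ ε := by ring
  ------------------------------------------------------------------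
  -- assemble (all pieces are of the form `T ≤ ϱ N · r`)
  have htotal := add_le_add (add_le_add (add_le_add (add_le_add (add_le_add (add_le_add
    (add_le_add hb1 hb2) hb3) hb4) (add_le_add hb5 hb6)) (add_le_add hb7 hb8)) (add_le_add hb9 hb8)) hb11
  refine le_trans (le_of_eq ?_) (htotal.trans (le_of_eq ?_))
  · ring
  · ring

end Literature.Barriers.Parity
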